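import Summits.CriticalPhenomena.PercolationContinuityZ3.Theorems.Transplant.PlanarCells2SepInf
import Summits.CriticalPhenomena.PercolationContinuityZ3.Theorems.Transplant.PlanarCells2Levels
import Summits.CriticalPhenomena.PercolationContinuityZ3.Theorems.Transplant.SkelPhiWindowMargin
import HarnessLib

/-!
# N1 ({±1} node) scheme geometry over a NON-STEP cell map, planar part (hp-8 g33; design owner's assignment 2026-08-21 13:26Z): the far region with ONE
# unit of transverse slack `PCells2.EfarN₂` (half-width `5r⊥ − 2`), the SLACK BOXES a weak step may land in, and the one-shared-level MARGINS

builds on p205010 (kernel theorem, internal audit signed; external expert review pending) — nothing in this file uses p205010; pure planar arithmetic.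
Lane `prim-bschramm`, seat `prim-hp-8` (gen 33); helper file (`--supports stmt-CriticalPhenomena-4575 --as helper`).
WHY.  Over a window map `ψ` WITHOUT unit steps (the fine cell map `Skelφ.fineSkel` of N1) the D″ cover `VWin(EfarN) ⊆ VWin(BtwN) ∪ VWin(Q(v+δ))`
(`SepGeom.Efar_subset_Btw_union_Q`) can FAIL: `EfarN` and `BtwN` have the same transverse half-width `5r⊥ − 1` and abut `Q(v+δ)` with no shared level, so a
vertex at the corner footprint whose span partner sits across the level boundary and whose monotone ("weak") steps move outward lies in neither span.
The N1 record therefore uses `EfarN₂` (transverse half-width `5r⊥ − 2`): a weak step from a point of `EfarN₂` away from the level boundary lands in a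
box of the shape `{level ∈ [ℓ, ℓ+1] or [ℓ−1, ℓ], |Δ transverse| ≤ 1}`, and these SLACK BOXES lie in `BtwN` resp. `Q(v+δ)` (§2).  The same slack boxes
serve `Stub ⊆ Q ∪ BtwN` and `Hfull ⊆ Q ∪ EfarN₂` (sources of half-width `2r⊥`).  Covers across a SHARED level (`BtwN ⊆ Cell v ∪ Cell(v+δ)`,
`Stub ⊆ Cell v ∪ Zone`) need no step at all: they have the adjacency margin of p3-g8's `SkelPhiWindowMargin` — with the sharp threshold form
`adjMargin_of_threshold_le/ge` (ONE shared level suffices; `adjMargin_of_threshold` asks for two) (§3).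
* §1 `EfarN₂`, `EfarN₂_subset_EfarN`, `M_add_stepVec_subset_EfarN₂`, `mem_EfarN₂_of_mem_Hfull`, `lev_le_of_mem_Hfull_not_EfarN₂'`, `lev_bounds_of_mem_EfarN₂`;
* §2 slack boxes: `upBox_subset_BtwN`, `downBox_subset_BtwN`, `upBox_subset_Q_add`, `downBox_subset_Q_add`, `downBox_subset_Q`, `upBox_subset_EfarN₂`;
* §3 `Skelφ.adjMargin_of_threshold_le/ge`, `PCells2.adjMargin_BtwN_Cells`, `adjMargin_Stub_Cell_Zone`.
[cite: KozmaNitzan2024, §4 pp. 25–26 (Q_v, E_{v,x}, H_{v,x}), p. 30] [folklore]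
-/

namespace Summit.CriticalPhenomena.PercolationContinuityZ3.Theorems.Transplant

open Literature.Probability.Percolation Literature.Probability.LatticeModels
open Literature.Probability.Percolation.KozmaNitzan
open Literature.Probability.Percolation.KozmaNitzan.Cells (oth oth_ne sgOf sgOf_sign stepVec_apply_fst stepVec_apply_oth eq_oth_of_ne oth_oth)
open PCells (mem_psBox_iff)

/-! ## §3 (first, map-free) One shared level gives the adjacency margin -/

namespace Skelφ

/-- **Sharp threshold margin (increasing)**: if the points of `A` with `s i ≤ c` lie in `B` and those with `c ≤ s i` lie in `B′` (ONE shared level `c`), the cover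
has the adjacency margin. [folklore] -/
theorem adjMargin_of_threshold_le {A B B' : Finset (Site 2)} (i : Fin 2) (c : ℤ) (hB : ∀ s ∈ A, s i ≤ c → s ∈ B)
    (hB' : ∀ s ∈ A, c ≤ s i → s ∈ B') : AdjMargin A B B' := by
  intro s hs s' hs' hss'
  have hi := abs_le.1 (hss' i)
  rcases lt_trichotomy (s i) c with h1 | h1 | h1
  · exact Or.inl ⟨hB s hs h1.le, hB s' hs' (by omega)⟩
  · rcases le_or_gt (s' i) c with h2 | h2
    · exact Or.inl ⟨hB s hs h1.le, hB s' hs' h2⟩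
    · exact Or.inr ⟨hB' s hs h1.ge, hB' s' hs' h2.le⟩
  · exact Or.inr ⟨hB' s hs h1.le, hB' s' hs' (by omega)⟩

/-- **Sharp threshold margin (decreasing)**: points with `c ≤ s i` in `B`, points with `s i ≤ c` in `B′`. [folklore] -/
theorem adjMargin_of_threshold_ge {A B B' : Finset (Site 2)} (i : Fin 2) (c : ℤ) (hB : ∀ s ∈ A, c ≤ s i → s ∈ B)
    (hB' : ∀ s ∈ A, s i ≤ c → s ∈ B') : AdjMargin A B B' := by
  intro s hs s' hs' hss'
  rcases adjMargin_of_threshold_le i c hB' hB s hs s' hs' hss' with h | h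
  · exact Or.inr h
  · exact Or.inl h

end Skelφ

namespace PCells2

variable (P : PCells2)

/-! ## §1 The far region with one unit of transverse slack -/

/-- **The twice-narrowed far region** `cen v + {5r∥ < σ x_a ≤ 25r∥} × [−(5r⊥−2), 5r⊥−2]` (one unit inside `EfarN` across). [cite: KozmaNitzan2024, §4 p. 26 (E_{v,x})] -/
noncomputable def EfarN₂ (v : Site 2) (δ : MDir) : Finset (Site 2) :=
  sBox δ.1 (sgOf δ) (P.cen v) (5 * P.r δ.1 + 1) (25 * P.r δ.1) (5 * P.r (oth δ.1) - 2)

/-- `EfarN₂ ⊆ EfarN`. [folklore] -/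
theorem EfarN₂_subset_EfarN (v : Site 2) (δ : MDir) : P.EfarN₂ v δ ⊆ P.EfarN v δ := by
  intro t ht
  rw [EfarN₂, mem_psBox_iff] at ht
  rw [EfarN, mem_psBox_iff]
  exact ⟨ht.1, by omega, by omega⟩

/-- Level and transverse bounds of a point of `EfarN₂`. [folklore] -/
theorem lev_bounds_of_mem_EfarN₂ {v : Site 2} {δ : MDir} {t : Site 2} (ht : t ∈ P.EfarN₂ v δ) :
    5 * (P.r δ.1 : ℤ) + 1 ≤ P.lev δ v t ∧ P.lev δ v t ≤ 25 * P.r δ.1 ∧ |t (oth δ.1) - P.cen v (oth δ.1)| ≤ 5 * P.r (oth δ.1) - 2 := by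
  rw [EfarN₂, mem_psBox_iff] at ht
  unfold lev
  exact ⟨ht.1.1, ht.1.2, abs_le.2 ⟨by omega, by omega⟩⟩

/-- Membership in `EfarN₂` from the level and the transverse bound. [folklore] -/
theorem mem_EfarN₂_of_bounds {v : Site 2} {δ : MDir} {t : Site 2} (h1 : 5 * (P.r δ.1 : ℤ) + 1 ≤ P.lev δ v t) (h2 : P.lev δ v t ≤ 25 * P.r δ.1)
    (h3 : |t (oth δ.1) - P.cen v (oth δ.1)| ≤ 5 * P.r (oth δ.1) - 2) : t ∈ P.EfarN₂ v δ := by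
  rw [EfarN₂, mem_psBox_iff]
  unfold lev at h1 h2
  have := abs_le.1 h3
  exact ⟨⟨h1, h2⟩, by omega, by omega⟩

/-- `M_{v+δ} ⊆ EfarN₂_{v,δ}` (`3r⊥ ≤ 5r⊥ − 2`). [folklore] -/
theorem M_add_stepVec_subset_EfarN₂ (v : Site 2) (δ : MDir) : (P.M (v + stepVec δ) : Finset (Site 2)) ⊆ P.EfarN₂ v δ := by
  intro t ht
  rw [M, mem_abox_iff] at ht
  rw [EfarN₂, mem_psBox_iff]
  have hf := P.cen_add_stepVec_fst v δ
  have ho := P.cen_add_stepVec_oth v δ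
  have ha := ht δ.1
  have hb := ht (oth δ.1)
  rw [hf] at ha
  rw [ho] at hb
  push_cast at ha hb
  have hr : (1 : ℤ) ≤ P.r δ.1 := by exact_mod_cast P.one_le_r δ.1
  have hr' : (1 : ℤ) ≤ P.r (oth δ.1) := by exact_mod_cast P.one_le_r (oth δ.1)
  refine ⟨?_, by omega, by omega⟩
  rcases sgOf_sign δ with hs | hs <;> rw [hs] at ha ⊢ <;> constructor <;> omega

/-- A corridor point of level `≥ 5r∥ + 1` lies in `EfarN₂` (corridor half-width `2r⊥ ≤ 5r⊥ − 2`). [folklore] -/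
theorem mem_EfarN₂_of_mem_Hfull {δ : MDir} {v t : Site 2} (ht : t ∈ P.Hfull v δ) (hl : 5 * (P.r δ.1 : ℤ) + 1 ≤ P.lev δ v t) :
    t ∈ P.EfarN₂ v δ := by
  rw [Hfull, mem_psBox_iff] at ht
  rw [EfarN₂, mem_psBox_iff]
  unfold lev at hl
  have := P.one_le_r (oth δ.1)
  exact ⟨⟨hl, by omega⟩, by omega, by omega⟩

/-- A corridor point off `EfarN₂` has level `≤ 5r∥`. [folklore] -/
theorem lev_le_of_mem_Hfull_not_EfarN₂' {δ : MDir} {v t : Site 2} (ht : t ∈ P.Hfull v δ) (hn : t ∉ P.EfarN₂ v δ) :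
    P.lev δ v t ≤ 5 * P.r δ.1 := by
  by_contra h
  exact hn (P.mem_EfarN₂_of_mem_Hfull ht (by omega))

/-- `Hfull ⊆ Q_v ∪ EfarN₂`. [folklore] -/
theorem Hfull_subset_Q_union_EfarN₂ (v : Site 2) (δ : MDir) : (P.Hfull v δ : Finset (Site 2)) ⊆ P.Q v ∪ P.EfarN₂ v δ := by
  intro t ht
  rw [Finset.mem_union]
  by_cases hlev : P.lev δ v t ≤ 5 * P.r δ.1
  · left
    rcases Finset.mem_union.1 (P.Hfull_subset_Q_union_EfarN v δ ht) with h | h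
    · exact h
    · exact absurd (P.lev_ge_of_mem_EfarN h) (by omega)
  · exact Or.inr (P.mem_EfarN₂_of_mem_Hfull ht (by omega))

/-! ## §2 Slack boxes: where a weak step from a point lands -/

/-- **Up-box into `BtwN`**: from a point `t` with transverse offset `≤ 5r⊥ − 2` and level in `[5r∥+1, 15r∥−2]`, every point one level up-or-equal and
transversally within one lies in `BtwN`. [folklore] -/
theorem upBox_subset_BtwN {v : Site 2} {δ : MDir} {t t' : Site 2} (htr : |t (oth δ.1) - P.cen v (oth δ.1)| ≤ 5 * P.r (oth δ.1) - 2)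
    (hl : 5 * (P.r δ.1 : ℤ) + 1 ≤ P.lev δ v t) (hu : P.lev δ v t ≤ 15 * P.r δ.1 - 2) (h1 : P.lev δ v t ≤ P.lev δ v t')
    (h2 : P.lev δ v t' ≤ P.lev δ v t + 1) (h3 : |t' (oth δ.1) - t (oth δ.1)| ≤ 1) : t' ∈ P.BtwN v δ := by
  rw [BtwN, mem_psBox_iff]
  unfold lev at hl hu h1 h2
  have := abs_le.1 htr; have := abs_le.1 h3
  exact ⟨⟨by omega, by omega⟩, by omega, by omega⟩

/-- **Down-box into `BtwN`**: level in `[5r∥+2, 15r∥−1]`, one level down-or-equal. [folklore] -/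
theorem downBox_subset_BtwN {v : Site 2} {δ : MDir} {t t' : Site 2} (htr : |t (oth δ.1) - P.cen v (oth δ.1)| ≤ 5 * P.r (oth δ.1) - 2)
    (hl : 5 * (P.r δ.1 : ℤ) + 2 ≤ P.lev δ v t) (hu : P.lev δ v t ≤ 15 * P.r δ.1 - 1) (h1 : P.lev δ v t' ≤ P.lev δ v t)
    (h2 : P.lev δ v t - 1 ≤ P.lev δ v t') (h3 : |t' (oth δ.1) - t (oth δ.1)| ≤ 1) : t' ∈ P.BtwN v δ := by
  rw [BtwN, mem_psBox_iff]
  unfold lev at hl hu h1 h2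
  have := abs_le.1 htr; have := abs_le.1 h3
  exact ⟨⟨by omega, by omega⟩, by omega, by omega⟩

/-- **Up-box into `Q_{v+δ}`**: level in `[15r∥, 25r∥−1]`, transverse offset `≤ 5r⊥ − 1`. [folklore] -/
theorem upBox_subset_Q_add {v : Site 2} {δ : MDir} {t t' : Site 2} (htr : |t (oth δ.1) - P.cen v (oth δ.1)| ≤ 5 * P.r (oth δ.1) - 1)
    (hl : 15 * (P.r δ.1 : ℤ) ≤ P.lev δ v t) (hu : P.lev δ v t ≤ 25 * P.r δ.1 - 1) (h1 : P.lev δ v t ≤ P.lev δ v t')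
    (h2 : P.lev δ v t' ≤ P.lev δ v t + 1) (h3 : |t' (oth δ.1) - t (oth δ.1)| ≤ 1) : t' ∈ P.Q (v + stepVec δ) := by
  rw [Q, mem_abox_iff]
  unfold lev at hl hu h1 h2
  have := abs_le.1 htr; have := abs_le.1 h3
  have hf := P.cen_add_stepVec_fst v δ
  have ho := P.cen_add_stepVec_oth v δ
  intro i
  rcases eq_or_ne i δ.1 with rfl | hi
  · rw [hf]; rcases sgOf_sign δ with hs | hs <;> rw [hs] at hl hu h1 h2 ⊢ <;> push_cast <;> constructor <;> omega
  · rw [eq_oth_of_ne hi, ho]; push_cast; constructor <;> omega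

/-- **Down-box into `Q_{v+δ}`**: level in `[15r∥+1, 25r∥]`. [folklore] -/
theorem downBox_subset_Q_add {v : Site 2} {δ : MDir} {t t' : Site 2} (htr : |t (oth δ.1) - P.cen v (oth δ.1)| ≤ 5 * P.r (oth δ.1) - 1)
    (hl : 15 * (P.r δ.1 : ℤ) + 1 ≤ P.lev δ v t) (hu : P.lev δ v t ≤ 25 * P.r δ.1) (h1 : P.lev δ v t' ≤ P.lev δ v t)
    (h2 : P.lev δ v t - 1 ≤ P.lev δ v t') (h3 : |t' (oth δ.1) - t (oth δ.1)| ≤ 1) : t' ∈ P.Q (v + stepVec δ) := by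
  rw [Q, mem_abox_iff]
  unfold lev at hl hu h1 h2
  have := abs_le.1 htr; have := abs_le.1 h3
  have hf := P.cen_add_stepVec_fst v δ
  have ho := P.cen_add_stepVec_oth v δ
  intro i
  rcases eq_or_ne i δ.1 with rfl | hi
  · rw [hf]; rcases sgOf_sign δ with hs | hs <;> rw [hs] at hl hu h1 h2 ⊢ <;> push_cast <;> constructor <;> omega
  · rw [eq_oth_of_ne hi, ho]; push_cast; constructor <;> omega

/-- **Down-box into `Q_v`**: from a point of transverse offset `≤ 5r⊥ − 1` with level in `[−5r∥+1, 5r∥]`. [folklore] -/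
theorem downBox_subset_Q {v : Site 2} {δ : MDir} {t t' : Site 2} (htr : |t (oth δ.1) - P.cen v (oth δ.1)| ≤ 5 * P.r (oth δ.1) - 1)
    (hl : -(5 * (P.r δ.1 : ℤ)) + 1 ≤ P.lev δ v t) (hu : P.lev δ v t ≤ 5 * P.r δ.1) (h1 : P.lev δ v t' ≤ P.lev δ v t)
    (h2 : P.lev δ v t - 1 ≤ P.lev δ v t') (h3 : |t' (oth δ.1) - t (oth δ.1)| ≤ 1) : t' ∈ P.Q v := by
  rw [Q, mem_abox_iff]
  unfold lev at hl hu h1 h2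
  have := abs_le.1 htr; have := abs_le.1 h3
  intro i
  rcases eq_or_ne i δ.1 with rfl | hi
  · rcases sgOf_sign δ with hs | hs <;> rw [hs] at hl hu h1 h2 <;> push_cast <;> constructor <;> omega
  · rw [eq_oth_of_ne hi]; push_cast; constructor <;> omega

/-- **Up-box into `EfarN₂`**: from a point of transverse offset `≤ 5r⊥ − 3` with level in `[5r∥+1, 25r∥−1]`. [folklore] -/
theorem upBox_subset_EfarN₂ {v : Site 2} {δ : MDir} {t t' : Site 2} (htr : |t (oth δ.1) - P.cen v (oth δ.1)| ≤ 5 * P.r (oth δ.1) - 3)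
    (hl : 5 * (P.r δ.1 : ℤ) + 1 ≤ P.lev δ v t) (hu : P.lev δ v t ≤ 25 * P.r δ.1 - 1) (h1 : P.lev δ v t ≤ P.lev δ v t')
    (h2 : P.lev δ v t' ≤ P.lev δ v t + 1) (h3 : |t' (oth δ.1) - t (oth δ.1)| ≤ 1) : t' ∈ P.EfarN₂ v δ := by
  rw [EfarN₂, mem_psBox_iff]
  unfold lev at hl hu h1 h2
  have := abs_le.1 htr; have := abs_le.1 h3
  exact ⟨⟨by omega, by omega⟩, by omega, by omega⟩

/-- Transverse offset and level range of a corridor point (`Hfull`: half-width `2r⊥ ≤ 5r⊥ − 3`, levels `[5r∥, 22r∥]`). [folklore] -/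
theorem bounds_of_mem_Hfull {v : Site 2} {δ : MDir} {t : Site 2} (ht : t ∈ P.Hfull v δ) :
    |t (oth δ.1) - P.cen v (oth δ.1)| ≤ 5 * P.r (oth δ.1) - 3 ∧ 5 * (P.r δ.1 : ℤ) ≤ P.lev δ v t ∧ P.lev δ v t ≤ 22 * P.r δ.1 := by
  rw [Hfull, mem_psBox_iff] at ht
  unfold lev
  have := P.one_le_r (oth δ.1)
  exact ⟨abs_le.2 ⟨by omega, by omega⟩, ht.1.1, ht.1.2⟩

/-- Transverse offset and level range of a stub point (`Stub j`, `j < K`: levels `[5r∥, 15r∥ − 10s∥]`). [folklore] -/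
theorem bounds_of_mem_Stub {v : Site 2} {δ : MDir} {j : ℕ} (hj : j < P.K) {t : Site 2} (ht : t ∈ P.Stub v δ j) :
    |t (oth δ.1) - P.cen v (oth δ.1)| ≤ 5 * P.r (oth δ.1) - 3 ∧ 5 * (P.r δ.1 : ℤ) ≤ P.lev δ v t ∧ P.lev δ v t ≤ 15 * P.r δ.1 - 10 * P.s δ.1 := by
  rw [Stub, mem_psBox_iff] at ht
  unfold lev
  have := P.one_le_r (oth δ.1)
  have hrK : (P.r δ.1 : ℤ) = P.K * P.s δ.1 := P.r_eq δ.1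
  have hs1 : (1 : ℤ) ≤ P.s δ.1 := by exact_mod_cast P.hs δ.1
  have hjK : (j : ℤ) + 1 ≤ P.K := by exact_mod_cast hj
  refine ⟨abs_le.2 ⟨by omega, by omega⟩, ht.1.1, ht.1.2.trans ?_⟩
  nlinarith

/-! ## §3 Margins across a shared level -/

/-- **`BtwN ⊆ Cell v ∪ Cell(v+δ)` with the adjacency margin** (shared level `10r∥`). [folklore] -/
theorem adjMargin_BtwN_Cells (v : Site 2) (δ : MDir) : Skelφ.AdjMargin (P.BtwN v δ) (P.Cell v) (P.Cell (v + stepVec δ)) := by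
  have hf := P.cen_add_stepVec_fst v δ
  have ho := P.cen_add_stepVec_oth v δ
  -- membership tests along the axis of `δ`
  have hCv : ∀ s ∈ P.BtwN v δ, sgOf δ * (s δ.1 - P.cen v δ.1) ≤ 10 * P.r δ.1 → s ∈ P.Cell v := by
    intro s hs hle
    rw [BtwN, mem_psBox_iff] at hs
    rw [Cell, mem_abox_iff]
    intro i
    rcases eq_or_ne i δ.1 with rfl | hi
    · rcases sgOf_sign δ with h | h <;> rw [h] at hs hle <;> push_cast <;> constructor <;> omega
    · rw [eq_oth_of_ne hi]; push_cast; constructor <;> omega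
  have hCw : ∀ s ∈ P.BtwN v δ, 10 * (P.r δ.1 : ℤ) ≤ sgOf δ * (s δ.1 - P.cen v δ.1) → s ∈ P.Cell (v + stepVec δ) := by
    intro s hs hge
    rw [BtwN, mem_psBox_iff] at hs
    rw [Cell, mem_abox_iff]
    intro i
    rcases eq_or_ne i δ.1 with rfl | hi
    · rw [hf]; rcases sgOf_sign δ with h | h <;> rw [h] at hs hge ⊢ <;> push_cast <;> constructor <;> omega
    · rw [eq_oth_of_ne hi, ho]; push_cast; constructor <;> omega
  rcases sgOf_sign δ with h | h
  · refine Skelφ.adjMargin_of_threshold_le δ.1 (P.cen v δ.1 + 10 * P.r δ.1) (fun s hs hle => hCv s hs ?_) (fun s hs hge => hCw s hs ?_)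
    · rw [h]; omega
    · rw [h]; omega
  · refine Skelφ.adjMargin_of_threshold_ge δ.1 (P.cen v δ.1 - 10 * P.r δ.1) (fun s hs hge => hCv s hs ?_) (fun s hs hle => hCw s hs ?_)
    · rw [h]; omega
    · rw [h]; omega

/-- **`Stub_j ⊆ Cell v ∪ Zone` with the adjacency margin** (`j < K`; shared level `10r∥`, equal transverse half-widths). [folklore] -/
theorem adjMargin_Stub_Cell_Zone (v : Site 2) (δ : MDir) {j : ℕ} (hj : j < P.K) : Skelφ.AdjMargin (P.Stub v δ j) (P.Cell v) (P.Zone v δ) := by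
  have hCv : ∀ s ∈ P.Stub v δ j, sgOf δ * (s δ.1 - P.cen v δ.1) ≤ 10 * P.r δ.1 → s ∈ P.Cell v := by
    intro s hs hle
    have hb := P.bounds_of_mem_Stub hj hs
    have htr := abs_le.1 hb.1
    unfold lev at hb
    rw [Cell, mem_abox_iff]
    intro i
    rcases eq_or_ne i δ.1 with rfl | hi
    · rcases sgOf_sign δ with h | h <;> rw [h] at hb hle <;> push_cast <;> constructor <;> omega
    · rw [eq_oth_of_ne hi]; push_cast; constructor <;> omega
  have hZ : ∀ s ∈ P.Stub v δ j, 10 * (P.r δ.1 : ℤ) ≤ sgOf δ * (s δ.1 - P.cen v δ.1) → s ∈ P.Zone v δ := by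
    intro s hs hge
    have hb := P.bounds_of_mem_Stub hj hs
    rw [Stub, mem_psBox_iff] at hs
    unfold lev at hb
    rw [Zone, mem_psBox_iff]
    exact ⟨⟨hge, hb.2.2⟩, hs.2⟩
  rcases sgOf_sign δ with h | h
  · refine Skelφ.adjMargin_of_threshold_le δ.1 (P.cen v δ.1 + 10 * P.r δ.1) (fun s hs hle => hCv s hs ?_) (fun s hs hge => hZ s hs ?_)
    · rw [h]; omega
    · rw [h]; omega
  · refine Skelφ.adjMargin_of_threshold_ge δ.1 (P.cen v δ.1 - 10 * P.r δ.1) (fun s hs hge => hCv s hs ?_) (fun s hs hle => hZ s hs ?_)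
    · rw [h]; omega
    · rw [h]; omega

end PCells2

end Summit.CriticalPhenomena.PercolationContinuityZ3.Theorems.Transplant
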